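import Summits.BirchSwinnertonDyer.BirchSwinnertonDyer.Theorems.KatoDescentPotSupersingularWildJetchevBoundAtPSwapGuard
import Summits.BirchSwinnertonDyer.BirchSwinnertonDyer.Theorems.KatoDescentTamePotSupersingularJetchevIrreducibleSwapLevelRaisingNamedPrint
import Summits.BirchSwinnertonDyer.BirchSwinnertonDyer.Theorems.KatoDescentTamePotSupersingularJetchevIrreducibleCoreVertexNamedFacts
import Summits.BirchSwinnertonDyer.BirchSwinnertonDyer.Theorems.Rank1ResidualJetSection6BridgeSwap
import HarnessLib

/-!
# Shared crux `JetchevIrreducibleReadingByName` (item 20165, K8-t′ / K9), node S2 `Sig.S2DivisibilityIrredAddv` (Jetchev Thm. 1.4 (ii),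
# irreducible reading, carrier `q ≠ p`): the swap node AT ONE ROW under the widened guard — S2 ⟸ {Gross 1991 Prop. 3.7 (2),
# Poitou–Tate, [GZ86 III (3.1)] image-free} on every row whose Kolyvagin prime `2` (if any) sees a surjective `ρ̄_{E,p}`,
# hence on EVERY row in a Heegner field in which `2` splits (the K9/KT J08 roads' field) and on every row with `p ≠ 3`

Cell `bsd-potss`, seat `bsd-potss-k9-c4` g11 (prover); `--supports stmt-BirchSwinnertonDyer-20165`, helper; route-free; CONDITIONAL on
the displayed named facts; nothing booked, no item closed, BSD is not proved by any of this. LANE: k8t-c4 g12 owns the node BY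
SCHEMA (`JetchevIrreducibleSwap.divisibilityIrredAddv_of_levelRaisingIrred_…`, p559604, keyed on the CLOSED level-raising schema
`hRaiseI`, supplied for `p ≠ 3`); this file is the K9-face complement: the SAME node at one row, keyed on the ROW-LEVEL `hraise`,
so that the `p = 3` rows are reached under the one row condition «`2` Zhang–Kolyvagin for `(E, K, p)` ⇒ `ρ̄_{E,p}` onto»
(this seat's `…WildJetchevBoundAtPSwapGuard`: free for `p ≠ 3`, free when `2` splits in `K`, free on the mod-`p`-onto rows).

RESULTS: §1 `rowDivisibilityIrredAddv_of_levelRaising_of_coreVertexExistenceIrredPlt_of_thm63` (pv-2's image-free bridge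
`JET.derivedPoint_divisible_of_levelRaising_of_section6_min` at one frame, fed with the frame's `hraise`, k9-c4 g10's S3′-lt through
`JetchevIrreducibleCoreVertex.exists_coreVertex_of_coreVertexExistenceIrredPlt`, and the closed Thm. 6.3 clause `H63I` = `Sig.H63IRowObjectsAddv`);
§2 `rowDivisibilityIrredAddv_of_h47PG_of_poitouTate_of_GZ31g` (⟸ the widened reading `h47PG`, `hPT`, `hGZg` + the row condition;
`hraise` by k8t-c4 g12's G-generic walk supplier `levelRaising_of_h47row_of_poitouTate_of_GZ31_of_irreducible` at `G := (· ≠ 2 ∨ ρ̄_p onto)`,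
S3′-lt by `coreVertexExistenceIrredP_lt_of_prop47P2_of_poitouTate_of_GZ31g`, H63I by
`JetchevIrreducibleReadingThm52Gross1991.h63IRowObjectsAddv_of_poitouTate_of_GZ31g_of_prop47P2`); §3
`rowDivisibilityIrredAddv_of_prop37_2_of_poitouTate_of_Gross1991` (⟸ the three NAMED FACTS + the row condition) with the
guard-free instances `…_of_heegnerHypothesis_two`, `…_of_ne_three` (the onto rows: feed `fun _ ↦ hsurj`).

References (locators only; cited FACTS enter as hypotheses, never declared): [cite: Jetchev2008, Thm. 1.4 (ii) and proof (p. 824),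
Prop. 5.3, Thm. 5.2, Rem. 6.2] [cite: McCallumLMS1991, §4 Prop. 4.4, §5 Prop. 5.2 and proof (pp. 304–306)]
[cite: GrossLMS1991, §3 (3.3), Prop. 3.7 (2), §6 p. 245] [cite: GrossZagier1986, III (3.1)] [cite: MilneADT2006, Ch. I, Thm. 4.10].
Design: theorems only; `K : Type`. Axioms: `propext`, `Classical.choice`, `Quot.sound`.
-/

set_option autoImplicit false
-- the Theorems directory repeats the summit name (sibling precedent `KatoDescentPotSupersingularAssembly.lean`)
set_option linter.dupNamespace false

noncomputable section

open scoped Classical NumberField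

open WeierstrassCurve IsDedekindDomain NumberField Literature.NumberTheory.EllipticCurves
  Literature.NumberTheory.EllipticCurves.ModularForms Literature.NumberTheory.EllipticCurves.Jetchev2008
  Literature.NumberTheory.EllipticCurves.Rank1Residual
  Literature.NumberTheory.GaloisRepresentations Literature.NumberTheory.GaloisCohomology
  Summit.BirchSwinnertonDyer.Rank1Residual Summit.BirchSwinnertonDyer.Rank1Residual.X11b
  Summit.BirchSwinnertonDyer.Rank1Residual.JET
  Summit.BirchSwinnertonDyer.BirchSwinnertonDyer.Theorems.JetchevIrreducibleCoreVertex

namespace Summit.BirchSwinnertonDyer.BirchSwinnertonDyer.Theorems.JetchevIrreducibleSwapAtP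

/-! ## §1 The S2′-free bridge at one frame, carrier `q ≠ p` -/

/-- **S2 (carrier `q ≠ p`) at one frame from LEVEL RAISING (no Prop. 5.2)**: on a row `E[p]` irreducible, additive potentially good
`p` with `p ∤ c_p`, the global Tamagawa binder, non-CM, a multiplicative carrier `q ∥ N_E`, `q ≠ p`, and a frame `(Dt, β, ι)` whose
conductor-`1` derived point has infinite order: pv-2's bridge fed with the frame's `hraise`, the `s < m` form `hCVIlt` of Jetchev
Prop. 5.3 (closed schema) and the Thm. 6.3 clause `H63I` (closed schema = `Sig.H63IRowObjectsAddv`). = k8t-c4 g12's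
`JetchevIrreducibleSwap.divisibilityIrredAddv_of_levelRaisingIrred_…` at ONE frame with the closed `hRaiseI` replaced by the frame's
`hraise`. CONDITIONAL on the displayed schemas; nothing asserted. [cite: Jetchev2008, Thm. 1.4 (proof, p. 824), Prop. 5.3, Thm. 5.2]
[cite: McCallumLMS1991, §5 proof of Prop. 5.2 (pp. 305–306)] -/
theorem rowDivisibilityIrredAddv_of_levelRaising_of_coreVertexExistenceIrredPlt_of_thm63
    (hCVIlt : ∀ (W : WeierstrassCurve ℚ) [W.IsElliptic] [W.IsGloballyMinimal] [NeZero (W.conductorNorm ℤ)],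
        ¬ W.HasCM →
        ∀ (K : Type) [Field K] [NumberField K], IsImaginaryQuadratic K →
        NumberField.discr K ≠ -3 → NumberField.discr K ≠ -4 →
        SatisfiesHeegnerHypothesis (W.conductorNorm ℤ) K →
        ∀ (τ : K ≃ₐ[ℚ] K), τ ≠ 1 →
        ∀ (p : ℕ) [Fact p.Prime], p ≠ 2 → W.HasIrreducibleModPGaloisRep p → (p : ℤ) ∣ W.conductorNorm ℤ →
        ∀ (Dt : ModularParametrizationData W (W.conductorNorm ℤ)) (β : ℤ) (ι : K →+* ℂ)
          [∀ k : ℕ, NumberField (ringClassField K ι k)]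
          (d₁ : KolyvaginHeegnerData Dt β ι 1), ¬ IsOfFinAddOrder d₁.derivedPoint →
        ∀ (m : ℕ), 1 ≤ m →
        ∀ (c : ℕ) (d : KolyvaginHeegnerData Dt β ι c), Squarefree c →
          (∀ ℓ ∈ c.primeFactors, Zhang2014.IsKolyvaginPrime (W.conductorNorm ℤ) W K p ℓ) →
        ∀ (s : ℕ), s < m → ¬ IsOfFinAddOrder d.derivedPoint →
          (∃ Q : (W.baseChange (ringClassField K ι c)).toAffine.Point,
            ((p ^ s : ℕ) : ℤ) • Q = d.derivedPoint) →
          (¬ ∃ Q : (W.baseChange (ringClassField K ι c)).toAffine.Point,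
            ((p ^ (s + 1) : ℕ) : ℤ) • Q = d.derivedPoint) →
          ((s + m : ℕ) : ℕ∞) ≤ Zhang2014.levelIndex W p c →
          ∃ (c' : ℕ) (d' : KolyvaginHeegnerData Dt β ι c'), Squarefree c' ∧
            (∀ ℓ ∈ c'.primeFactors, Zhang2014.IsKolyvaginPrime (W.conductorNorm ℤ) W K p ℓ ∧
              m + s ≤ Zhang2014.kolyvaginIndex W p ℓ) ∧
            Jetchev2008.IsGlobalCoreVertex W K ι τ p m c' ∧
            ¬ IsOfFinAddOrder d'.derivedPoint ∧
            ¬ ∃ Q : (W.baseChange (ringClassField K ι c')).toAffine.Point,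
              ((p ^ (s + 1) : ℕ) : ℤ) • Q = d'.derivedPoint)
    (H63I : ∀ (W : WeierstrassCurve ℚ) [W.IsElliptic] [W.IsGloballyMinimal] [NeZero (W.conductorNorm ℤ)],
      ¬ W.HasCM → ∀ (K : Type) [Field K] [NumberField K], IsImaginaryQuadratic K →
      NumberField.discr K ≠ -3 → NumberField.discr K ≠ -4 →
      SatisfiesHeegnerHypothesis (W.conductorNorm ℤ) K →
      ∀ (τ : K ≃ₐ[ℚ] K), τ ≠ 1 →
      ∀ (p : ℕ) [Fact p.Prime], p ≠ 2 → Addv W p → 0 ≤ padicValRat p W.j →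
      W.HasIrreducibleModPGaloisRep p →
      ¬ p ∣ (W.baseChange ℚ_[p]).localTamagawaNumber ℤ_[p] →
      (∀ (q' : ℕ) [Fact q'.Prime], q' ∣ W.conductorNorm ℤ →
        p ∣ (W.baseChange ℚ_[q']).localTamagawaNumber ℤ_[q'] → ¬ q' ^ 2 ∣ W.conductorNorm ℤ) →
      ∀ (Dt : ModularParametrizationData W (W.conductorNorm ℤ)) (β : ℤ) (ι : K →+* ℂ)
        [∀ k : ℕ, NumberField (ringClassField K ι k)]
        (d₁ : KolyvaginHeegnerData Dt β ι 1), ¬ IsOfFinAddOrder d₁.derivedPoint →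
      ∀ (q : ℕ) [Fact q.Prime], q ∣ W.conductorNorm ℤ → ¬ q ^ 2 ∣ W.conductorNorm ℤ → q ≠ p →
      ∀ (mdiv m : {c : ℕ // Squarefree c ∧ ∀ ℓ ∈ c.primeFactors,
          Zhang2014.IsKolyvaginPrime (W.conductorNorm ℤ) W K p ℓ} → ℕ∞),
      (∀ c (u : ℕ), (u : ℕ∞) ≤ mdiv c ↔ ∀ d : KolyvaginHeegnerData Dt β ι c.1,
        ∃ Q : (W.baseChange (ringClassField K ι c.1)).toAffine.Point,
          ((p ^ u : ℕ) : ℤ) • Q = d.derivedPoint) →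
      (∀ c, m c = if mdiv c < Zhang2014.levelIndex W p c.1 then mdiv c else ⊤) →
      ∀ mInf : ℕ, (∀ c, (mInf : ℕ∞) ≤ m c) →
        (∀ m' : ℕ, ∃ c, (m' : ℕ∞) ≤ Zhang2014.levelIndex W p c.1 ∧ m c = mInf) →
      ∀ (k : ℕ) c, 1 ≤ k → Jetchev2008.IsGlobalCoreVertex W K ι τ p k c.1 → m c = mInf →
        (k : ℕ∞) + mInf ≤ Zhang2014.levelIndex W p c.1 →
        padicValNat p ((W.baseChange ℚ_[q]).localTamagawaNumber ℤ_[q]) < k → mInf < k →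
        padicValNat p ((W.baseChange ℚ_[q]).localTamagawaNumber ℤ_[q]) ≤ mInf)
    (W : WeierstrassCurve ℚ) [W.IsElliptic] [W.IsGloballyMinimal] [NeZero (W.conductorNorm ℤ)]
    (hcm : ¬ W.HasCM) (K : Type) [Field K] [NumberField K] (hK : IsImaginaryQuadratic K)
    (hD3 : NumberField.discr K ≠ -3) (hD4 : NumberField.discr K ≠ -4)
    (hH : SatisfiesHeegnerHypothesis (W.conductorNorm ℤ) K) (τ : K ≃ₐ[ℚ] K) (hτ : τ ≠ 1)
    (p : ℕ) [Fact p.Prime] (hp2 : p ≠ 2) (hadd : Addv W p)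
    (hj : 0 ≤ padicValRat p W.j) (hirr : W.HasIrreducibleModPGaloisRep p)
    (hcp : ¬ p ∣ (W.baseChange ℚ_[p]).localTamagawaNumber ℤ_[p])
    (htam : ∀ (q' : ℕ) [Fact q'.Prime], q' ∣ W.conductorNorm ℤ →
      p ∣ (W.baseChange ℚ_[q']).localTamagawaNumber ℤ_[q'] → ¬ q' ^ 2 ∣ W.conductorNorm ℤ)
    (Dt : ModularParametrizationData W (W.conductorNorm ℤ)) (β : ℤ) (ι : K →+* ℂ)
    [∀ k : ℕ, NumberField (ringClassField K ι k)]
    (d₁ : KolyvaginHeegnerData Dt β ι 1) (hy : ¬ IsOfFinAddOrder d₁.derivedPoint)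
    (q : ℕ) [Fact q.Prime] (hqN : q ∣ W.conductorNorm ℤ) (hq2 : ¬ q ^ 2 ∣ W.conductorNorm ℤ) (hqp : q ≠ p)
    (hraise : ∀ (u : ℕ),
      (∀ (c : ℕ), Squarefree c →
        (∀ q ∈ c.primeFactors, Zhang2014.IsKolyvaginPrime (W.conductorNorm ℤ) W K p q ∧
          1 + u ≤ Zhang2014.kolyvaginIndex W p q) →
        ∀ dc : KolyvaginHeegnerData Dt β ι c,
        ∃ Q : (W.baseChange (ringClassField K ι c)).toAffine.Point,
          ((p ^ u : ℕ) : ℤ) • Q = dc.derivedPoint) →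
      ∀ (n₀ : ℕ), Squarefree n₀ →
        (∀ q ∈ n₀.primeFactors, Zhang2014.IsKolyvaginPrime (W.conductorNorm ℤ) W K p q ∧
          1 + u ≤ Zhang2014.kolyvaginIndex W p q) →
        ∀ d₀ : KolyvaginHeegnerData Dt β ι n₀,
        (¬ ∃ Q : (W.baseChange (ringClassField K ι n₀)).toAffine.Point,
          ((p ^ (u + 1) : ℕ) : ℤ) • Q = d₀.derivedPoint) →
        ∀ m' : ℕ, ∃ (n : ℕ) (d : KolyvaginHeegnerData Dt β ι n), Squarefree n ∧
          (∀ q ∈ n.primeFactors, Zhang2014.IsKolyvaginPrime (W.conductorNorm ℤ) W K p q ∧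
            max m' (1 + u) ≤ Zhang2014.kolyvaginIndex W p q) ∧
          ¬ ∃ Q : (W.baseChange (ringClassField K ι n)).toAffine.Point,
            ((p ^ (u + 1) : ℕ) : ℤ) • Q = d.derivedPoint) :
    ∀ (s : ℕ), s ≤ padicValNat p ((W.baseChange ℚ_[q]).localTamagawaNumber ℤ_[q]) →
      ∀ (n : ℕ) (d : KolyvaginHeegnerData Dt β ι n), Squarefree n →
        (∀ ℓ ∈ n.primeFactors, Zhang2014.IsKolyvaginPrime (W.conductorNorm ℤ) W K p ℓ ∧
          s ≤ Zhang2014.kolyvaginIndex W p ℓ) →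
        ∃ Q : (W.baseChange (ringClassField K ι n)).toAffine.Point,
          ((p ^ s : ℕ) : ℤ) • Q = d.derivedPoint := by
  intro s hs n d hn hℓ
  have hpN : p ∣ W.conductorNorm ℤ := (W.dvd_conductorNorm_iff_not_hasGoodReductionAtPrime p).mpr hadd.1
  refine derivedPoint_divisible_of_levelRaising_of_section6_min W K p Dt β ι
    (padicValNat p ((W.baseChange ℚ_[q]).localTamagawaNumber ℤ_[q])) hraise ?_ s hs n d hn hℓ
  intro mdiv m hchar hmdef mInf hmInf hKoly
  exact ⟨fun k c ↦ mInf < k → Jetchev2008.IsGlobalCoreVertex W K ι τ p k c.1,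
    fun k c hk hmc hMc ↦ by
      by_cases hik : mInf < k
      · obtain ⟨c', hcore, hM', hm'⟩ := exists_coreVertex_of_coreVertexExistenceIrredPlt hCVIlt W hcm K hK hD3
          hD4 hH τ hτ p hp2 hirr hpN Dt β ι d₁ hy mdiv m hchar hmdef mInf k c hk hmc hMc hik
        exact ⟨c', fun _ ↦ hcore, hM', hm'⟩
      · exact ⟨c, fun h ↦ absurd h hik, by rw [add_comm]; exact hMc, le_of_eq hmc⟩,
    fun k c hk hcore hmc hMc htk hik ↦ H63I W hcm K hK hD3 hD4 hH τ hτ p hp2 hadd hj hirr hcp htam Dt β ι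
      d₁ hy q hqN hq2 hqp mdiv m hchar hmdef mInf hmInf hKoly k c hk (hcore hik) hmc hMc htk hik⟩

/-! ## §2 S2 at every row from the three closed schemas {`h47PG`, `hPT`, `hGZg`} and the row guard -/

/-- **S2 (carrier `q ≠ p`) on a row of crux 20165 from the WIDENED reading `h47PG` (⟸ Gross 1991 Prop. 3.7 (2)), Poitou–Tate `hPT`
and the guarded image-free receptacle schema `hGZg` (⟸ [GZ86 III (3.1)]), under the ONE row condition «`2` Zhang–Kolyvagin for
`(E, K, p)` ⇒ `ρ̄_{E,p}` onto»** — NO S2′, NO S3′. Assembly as in the AtP twin (`…WildJetchevBoundAtPSwapNode` §2), the Thm. 6.3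
clause now k9-c4 g10's `JetchevIrreducibleReadingThm52Gross1991.h63IRowObjectsAddv_of_poitouTate_of_GZ31g_of_prop47P2`.
CONDITIONAL on the three schemas; nothing asserted. [cite: Jetchev2008, Thm. 1.4 (ii), Prop. 5.3, Thm. 5.2]
[cite: McCallumLMS1991, §4 Prop. 4.4, §5 proof of Prop. 5.2] [cite: GrossLMS1991, Prop. 3.7 (2)] [cite: GrossZagier1986, III (3.1)] -/
theorem rowDivisibilityIrredAddv_of_h47PG_of_poitouTate_of_GZ31g
    (h47PG : ∀ (W : WeierstrassCurve ℚ) [W.IsElliptic] [W.IsGloballyMinimal] [NeZero (W.conductorNorm ℤ)],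
        ¬ W.HasCM →
        ∀ (K : Type) [Field K] [NumberField K], IsImaginaryQuadratic K →
        NumberField.discr K ≠ -3 → NumberField.discr K ≠ -4 →
        SatisfiesHeegnerHypothesis (W.conductorNorm ℤ) K →
        ∀ (p : ℕ) [Fact p.Prime], p ≠ 2 → W.HasIrreducibleModPGaloisRep p → (p : ℤ) ∣ W.conductorNorm ℤ →
        ∀ (Dt : ModularParametrizationData W (W.conductorNorm ℤ)) (β : ℤ) (ι : K →+* ℂ)
          (M : ℕ), 1 ≤ M →
        ∀ (m l : ℕ), Squarefree (m * l) → l.Prime → (l ≠ 2 ∨ W.HasSurjectiveModNGaloisRep p) → ¬ l ∣ m →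
          (∀ l' ∈ (m * l).primeFactors, Zhang2014.IsKolyvaginPrime (W.conductorNorm ℤ) W K p l' ∧
            M ≤ Zhang2014.kolyvaginIndex W p l') →
        ∀ (d : KolyvaginHeegnerData Dt β ι m) (d' : KolyvaginHeegnerData Dt β ι (m * l)),
          (∀ l' ∈ m.primeFactors, ∀ (x : ringClassField K ι m) (x' : ringClassField K ι (m * l)),
            (x : ℂ) = x' → ((d'.σ l' x' : ringClassField K ι (m * l)) : ℂ) = (d.σ l' x : ℂ)) →
          (∀ s ∈ d.S, ∃ s' ∈ d'.S, ∀ (x : ringClassField K ι m) (x' : ringClassField K ι (m * l)),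
            (x : ℂ) = x' → ((s' x' : ringClassField K ι (m * l)) : ℂ) = (s x : ℂ)) →
          (∀ s' ∈ d'.S, ∃ s ∈ d.S, ∀ (x : ringClassField K ι m) (x' : ringClassField K ι (m * l)),
            (x : ℂ) = x' → ((s' x' : ringClassField K ι (m * l)) : ℂ) = (s x : ℂ)) →
          (∀ (x : ringClassField K ι m) (x' : ringClassField K ι (m * l)),
            (x : ℂ) = x' → d'.emb x' = d.emb x) →
        ∀ (v : HeightOneSpectrum (𝓞 K)), (l : 𝓞 K) ∈ v.asIdeal →
        ∀ (j : ℕ),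
          (((p ^ j : ℕ) : ℤ) • d'.kolyvaginClass (Fact.out : p.Prime) M ∈
              (W.baseChange K).torsionLocalKer (v.adicCompletion K) ((p ^ M : ℕ) : ℤ) ↔
            ((p ^ j : ℕ) : ℤ) • d.kolyvaginClass (Fact.out : p.Prime) M ∈
              (W.baseChange K).torsionLocalKer (v.adicCompletion K) ((p ^ M : ℕ) : ℤ)))
    (hPT : ∀ (K : Type) [Field K] [NumberField K], poitouTate_selmerStructure_duality_conj K)
    (hGZg : ∀ (W : WeierstrassCurve ℚ) [W.IsElliptic] [W.IsGloballyMinimal] [NeZero (W.conductorNorm ℤ)]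
      (K : Type) [Field K] [NumberField K], IsImaginaryQuadratic K →
      NumberField.discr K ≠ -3 → NumberField.discr K ≠ -4 →
      SatisfiesHeegnerHypothesis (W.conductorNorm ℤ) K →
      ∀ (p : ℕ) [Fact p.Prime], p ≠ 2 → W.HasIrreducibleModPGaloisRep p →
      ∀ (Dt : ModularParametrizationData W (W.conductorNorm ℤ)) (β : ℤ) (ι : K →+* ℂ)
      [∀ j : ℕ, NumberField (ringClassField K ι j)],
      ∃ n' : ℤ, IsCoprime (p : ℤ) n' ∧ ∀ (m : ℕ), Squarefree m →
        (∀ q ∈ m.primeFactors, Zhang2014.IsKolyvaginPrime (W.conductorNorm ℤ) W K p q) →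
        ∀ (dm : KolyvaginHeegnerData Dt β ι m)
        (γ : ringClassField K ι m ≃ₐ[ℚ] ringClassField K ι m), γ ∈ ringClassGal ι m →
        ∀ v : HeightOneSpectrum (𝓞 K), ¬ (W.baseChange K).HasGoodReductionAt v →
          n' • pointsMap (W.baseChange K) (v.adicCompletion K)
              (dm.toGeomPoints (pointGalHom W (ringClassField K ι m) γ dm.y)) ∈
            E0Receptacle (W.baseChange K) v ∧
          ∀ (ℓ : ℕ), ℓ ∈ m.primeFactors → ∀ (dm' : KolyvaginHeegnerData Dt β ι (m / ℓ))
            (hle : ringClassField K ι (m / ℓ) ≤ ringClassField K ι m),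
            n' • pointsMap (W.baseChange K) (v.adicCompletion K)
                (dm.toGeomPoints (pointGalHom W (ringClassField K ι m) γ
                  (WeierstrassCurve.Affine.Point.map (W' := W)
                    ((RingClassField.inclusion ι hle).restrictScalars ℚ) dm'.y))) ∈
              E0Receptacle (W.baseChange K) v) :
    ∀ (W : WeierstrassCurve ℚ) [W.IsElliptic] [W.IsGloballyMinimal] [NeZero (W.conductorNorm ℤ)],
      ¬ W.HasCM →
      ∀ (K : Type) [Field K] [NumberField K], IsImaginaryQuadratic K →
      NumberField.discr K ≠ -3 → NumberField.discr K ≠ -4 →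
      SatisfiesHeegnerHypothesis (W.conductorNorm ℤ) K →
      ∀ (p : ℕ) [Fact p.Prime], p ≠ 2 → Addv W p → 0 ≤ padicValRat p W.j →
      W.HasIrreducibleModPGaloisRep p →
      ¬ p ∣ (W.baseChange ℚ_[p]).localTamagawaNumber ℤ_[p] →
      (∀ (q' : ℕ) [Fact q'.Prime], q' ∣ W.conductorNorm ℤ →
        p ∣ (W.baseChange ℚ_[q']).localTamagawaNumber ℤ_[q'] → ¬ q' ^ 2 ∣ W.conductorNorm ℤ) →
      (Zhang2014.IsKolyvaginPrime (W.conductorNorm ℤ) W K p 2 → W.HasSurjectiveModNGaloisRep p) →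
      ∀ (Dt : ModularParametrizationData W (W.conductorNorm ℤ)) (β : ℤ) (ι : K →+* ℂ)
        (d₁ : KolyvaginHeegnerData Dt β ι 1), ¬ IsOfFinAddOrder d₁.derivedPoint →
      ∀ (q : ℕ) [Fact q.Prime], q ∣ W.conductorNorm ℤ → ¬ q ^ 2 ∣ W.conductorNorm ℤ → q ≠ p →
      ∀ (s : ℕ), s ≤ padicValNat p ((W.baseChange ℚ_[q]).localTamagawaNumber ℤ_[q]) →
      ∀ (n : ℕ) (d : KolyvaginHeegnerData Dt β ι n), Squarefree n →
        (∀ ℓ ∈ n.primeFactors, Zhang2014.IsKolyvaginPrime (W.conductorNorm ℤ) W K p ℓ ∧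
          s ≤ Zhang2014.kolyvaginIndex W p ℓ) →
        ∃ Q : (W.baseChange (ringClassField K ι n)).toAffine.Point,
          ((p ^ s : ℕ) : ℤ) • Q = d.derivedPoint := by
  intro W _ _ _ hcm K _ _ hK hD3 hD4 hH p _ hp2 hadd hj hirr hcp htam hR Dt β ι d₁ hy q _ hqN hq2 hqp
  have hp : p.Prime := Fact.out
  have hpN : p ∣ W.conductorNorm ℤ := (W.dvd_conductorNorm_iff_not_hasGoodReductionAtPrime p).mpr hadd.1
  obtain ⟨τ, hτ⟩ := exists_algEquiv_ne_one_of_isImaginaryQuadratic K hK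
  haveI : ∀ k : ℕ, NumberField (ringClassField K ι k) := fun k ↦
    Summit.BirchSwinnertonDyer.Rank1Residual.JET.numberField_ringClassField K hK ι k
  -- the registered `ℓ ≠ 2` reading is the `Or.inl` instance of the widened one
  have h47P2 : ∀ (W : WeierstrassCurve ℚ) [W.IsElliptic] [W.IsGloballyMinimal] [NeZero (W.conductorNorm ℤ)],
        ¬ W.HasCM →
        ∀ (K : Type) [Field K] [NumberField K], IsImaginaryQuadratic K →
        NumberField.discr K ≠ -3 → NumberField.discr K ≠ -4 →
        SatisfiesHeegnerHypothesis (W.conductorNorm ℤ) K →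
        ∀ (p : ℕ) [Fact p.Prime], p ≠ 2 → W.HasIrreducibleModPGaloisRep p → (p : ℤ) ∣ W.conductorNorm ℤ →
        ∀ (Dt : ModularParametrizationData W (W.conductorNorm ℤ)) (β : ℤ) (ι : K →+* ℂ)
          (M : ℕ), 1 ≤ M →
        ∀ (m l : ℕ), Squarefree (m * l) → l.Prime → l ≠ 2 → ¬ l ∣ m →
          (∀ l' ∈ (m * l).primeFactors, Zhang2014.IsKolyvaginPrime (W.conductorNorm ℤ) W K p l' ∧
            M ≤ Zhang2014.kolyvaginIndex W p l') →
        ∀ (d : KolyvaginHeegnerData Dt β ι m) (d' : KolyvaginHeegnerData Dt β ι (m * l)),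
          (∀ l' ∈ m.primeFactors, ∀ (x : ringClassField K ι m) (x' : ringClassField K ι (m * l)),
            (x : ℂ) = x' → ((d'.σ l' x' : ringClassField K ι (m * l)) : ℂ) = (d.σ l' x : ℂ)) →
          (∀ s ∈ d.S, ∃ s' ∈ d'.S, ∀ (x : ringClassField K ι m) (x' : ringClassField K ι (m * l)),
            (x : ℂ) = x' → ((s' x' : ringClassField K ι (m * l)) : ℂ) = (s x : ℂ)) →
          (∀ s' ∈ d'.S, ∃ s ∈ d.S, ∀ (x : ringClassField K ι m) (x' : ringClassField K ι (m * l)),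
            (x : ℂ) = x' → ((s' x' : ringClassField K ι (m * l)) : ℂ) = (s x : ℂ)) →
          (∀ (x : ringClassField K ι m) (x' : ringClassField K ι (m * l)),
            (x : ℂ) = x' → d'.emb x' = d.emb x) →
        ∀ (v : HeightOneSpectrum (𝓞 K)), (l : 𝓞 K) ∈ v.asIdeal →
        ∀ (j : ℕ),
          (((p ^ j : ℕ) : ℤ) • d'.kolyvaginClass (Fact.out : p.Prime) M ∈
              (W.baseChange K).torsionLocalKer (v.adicCompletion K) ((p ^ M : ℕ) : ℤ) ↔
            ((p ^ j : ℕ) : ℤ) • d.kolyvaginClass (Fact.out : p.Prime) M ∈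
              (W.baseChange K).torsionLocalKer (v.adicCompletion K) ((p ^ M : ℕ) : ℤ)) :=
    fun W _ _ _ hcm K _ _ hK hD3 hD4 hH p _ hp2 hirr hpN Dt β ι M hM m l hml hl hl2 hlm ↦
      h47PG W hcm K hK hD3 hD4 hH p hp2 hirr hpN Dt β ι M hM m l hml hl (Or.inl hl2) hlm
  -- [GZ86 III (3.1)] at this frame (guarded scoped schema)
  obtain ⟨n', hcop', hGZ'⟩ := hGZg W K hK hD3 hD4 hH p hp2 hirr Dt β ι
  -- level raising at minimal depth at this frame, guard `(· ≠ 2 ∨ ρ̄_p onto)`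
  have hraise := JetchevIrreducibleSwap.levelRaising_of_h47row_of_poitouTate_of_GZ31_of_irreducible W hK hD3 hD4 hH
    hcm τ hτ p hp2 hirr hpN Dt β ι (fun ℓ ↦ ℓ ≠ 2 ∨ W.HasSurjectiveModNGaloisRep p) (swapGuardOnto_of hR)
    (addOrderOf_localization_kolyvaginClass_eq_of_h47PG h47PG W hcm K hK hD3 hD4 hH p hp2 hirr hpN Dt β ι)
    (hPT K) hcop' hGZ'
  exact rowDivisibilityIrredAddv_of_levelRaising_of_coreVertexExistenceIrredPlt_of_thm63
    (coreVertexExistenceIrredP_lt_of_prop47P2_of_poitouTate_of_GZ31g h47P2 hPT hGZg)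
    (JetchevIrreducibleReadingThm52Gross1991.h63IRowObjectsAddv_of_poitouTate_of_GZ31g_of_prop47P2 h47P2 hPT hGZg)
    W hcm K hK hD3 hD4 hH τ hτ p hp2 hadd hj hirr hcp htam Dt β ι d₁ hy q hqN hq2 hqp hraise

/-! ## §3 S2 at every row from THREE NAMED FACTS and the row guard; the guard-free instances -/

/-- **S2 (carrier `q ≠ p`) on a row of crux 20165 from THREE NAMED LITERATURE FACTS** — `GrossLMS1991.prop37_2_frobeniusCongruence`,
`poitouTate_selmerStructure_duality_conj` (∀ K) and `Gross1991_heegnerPoint_sub_ratTorsion_mem_E0_imageFree` — under the row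
condition «`2` Zhang–Kolyvagin for `(E, K, p)` ⇒ `ρ̄_{E,p}` onto». = §2 ∘ {`h47PG_of_prop37_2`, `HeegnerE0ImageFree.forall_hGZ_of_Gross1991_imageFree`}.
CONDITIONAL on the three facts; nothing asserted. [cite: GrossLMS1991, Prop. 3.7 (2), §6 p. 245] [cite: MilneADT2006, Ch. I, Thm. 4.10(b)]
[cite: Jetchev2008, Thm. 1.4 (ii)] -/
theorem rowDivisibilityIrredAddv_of_prop37_2_of_poitouTate_of_Gross1991
    (h37 : GrossLMS1991.prop37_2_frobeniusCongruence)
    (hPT : ∀ (K : Type) [Field K] [NumberField K], poitouTate_selmerStructure_duality_conj K)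
    (hF1 : Gross1991_heegnerPoint_sub_ratTorsion_mem_E0_imageFree) :
    ∀ (W : WeierstrassCurve ℚ) [W.IsElliptic] [W.IsGloballyMinimal] [NeZero (W.conductorNorm ℤ)],
      ¬ W.HasCM →
      ∀ (K : Type) [Field K] [NumberField K], IsImaginaryQuadratic K →
      NumberField.discr K ≠ -3 → NumberField.discr K ≠ -4 →
      SatisfiesHeegnerHypothesis (W.conductorNorm ℤ) K →
      ∀ (p : ℕ) [Fact p.Prime], p ≠ 2 → Addv W p → 0 ≤ padicValRat p W.j →
      W.HasIrreducibleModPGaloisRep p →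
      ¬ p ∣ (W.baseChange ℚ_[p]).localTamagawaNumber ℤ_[p] →
      (∀ (q' : ℕ) [Fact q'.Prime], q' ∣ W.conductorNorm ℤ →
        p ∣ (W.baseChange ℚ_[q']).localTamagawaNumber ℤ_[q'] → ¬ q' ^ 2 ∣ W.conductorNorm ℤ) →
      (Zhang2014.IsKolyvaginPrime (W.conductorNorm ℤ) W K p 2 → W.HasSurjectiveModNGaloisRep p) →
      ∀ (Dt : ModularParametrizationData W (W.conductorNorm ℤ)) (β : ℤ) (ι : K →+* ℂ)
        (d₁ : KolyvaginHeegnerData Dt β ι 1), ¬ IsOfFinAddOrder d₁.derivedPoint →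
      ∀ (q : ℕ) [Fact q.Prime], q ∣ W.conductorNorm ℤ → ¬ q ^ 2 ∣ W.conductorNorm ℤ → q ≠ p →
      ∀ (s : ℕ), s ≤ padicValNat p ((W.baseChange ℚ_[q]).localTamagawaNumber ℤ_[q]) →
      ∀ (n : ℕ) (d : KolyvaginHeegnerData Dt β ι n), Squarefree n →
        (∀ ℓ ∈ n.primeFactors, Zhang2014.IsKolyvaginPrime (W.conductorNorm ℤ) W K p ℓ ∧
          s ≤ Zhang2014.kolyvaginIndex W p ℓ) →
        ∃ Q : (W.baseChange (ringClassField K ι n)).toAffine.Point,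
          ((p ^ s : ℕ) : ℤ) • Q = d.derivedPoint :=
  rowDivisibilityIrredAddv_of_h47PG_of_poitouTate_of_GZ31g (h47PG_of_prop37_2 h37) hPT
    (HeegnerE0ImageFree.forall_hGZ_of_Gross1991_imageFree hF1)

/-- **S2 on a row of crux 20165 in a Heegner field in which `2` SPLITS** (the J08 roads' Bump–Friedberg–Hoffstein field), from the
three named facts ONLY. CONDITIONAL on the three facts; nothing asserted. [cite: GrossLMS1991, Prop. 3.7 (2)] -/
theorem rowDivisibilityIrredAddv_of_namedFacts_of_heegnerHypothesis_two
    (h37 : GrossLMS1991.prop37_2_frobeniusCongruence)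
    (hPT : ∀ (K : Type) [Field K] [NumberField K], poitouTate_selmerStructure_duality_conj K)
    (hF1 : Gross1991_heegnerPoint_sub_ratTorsion_mem_E0_imageFree)
    (W : WeierstrassCurve ℚ) [W.IsElliptic] [W.IsGloballyMinimal] [NeZero (W.conductorNorm ℤ)]
    (hcm : ¬ W.HasCM) (K : Type) [Field K] [NumberField K] (hK : IsImaginaryQuadratic K)
    (hD3 : NumberField.discr K ≠ -3) (hD4 : NumberField.discr K ≠ -4)
    (hH : SatisfiesHeegnerHypothesis (W.conductorNorm ℤ) K) (h2K : SatisfiesHeegnerHypothesis 2 K)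
    (p : ℕ) [Fact p.Prime] (hp2 : p ≠ 2) (hadd : Addv W p)
    (hj : 0 ≤ padicValRat p W.j) (hirr : W.HasIrreducibleModPGaloisRep p)
    (hcp : ¬ p ∣ (W.baseChange ℚ_[p]).localTamagawaNumber ℤ_[p])
    (htam : ∀ (q' : ℕ) [Fact q'.Prime], q' ∣ W.conductorNorm ℤ →
      p ∣ (W.baseChange ℚ_[q']).localTamagawaNumber ℤ_[q'] → ¬ q' ^ 2 ∣ W.conductorNorm ℤ)
    (Dt : ModularParametrizationData W (W.conductorNorm ℤ)) (β : ℤ) (ι : K →+* ℂ)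
    (d₁ : KolyvaginHeegnerData Dt β ι 1) (hy : ¬ IsOfFinAddOrder d₁.derivedPoint)
    (q : ℕ) [Fact q.Prime] (hqN : q ∣ W.conductorNorm ℤ) (hq2 : ¬ q ^ 2 ∣ W.conductorNorm ℤ) (hqp : q ≠ p) :
    ∀ (s : ℕ), s ≤ padicValNat p ((W.baseChange ℚ_[q]).localTamagawaNumber ℤ_[q]) →
      ∀ (n : ℕ) (d : KolyvaginHeegnerData Dt β ι n), Squarefree n →
        (∀ ℓ ∈ n.primeFactors, Zhang2014.IsKolyvaginPrime (W.conductorNorm ℤ) W K p ℓ ∧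
          s ≤ Zhang2014.kolyvaginIndex W p ℓ) →
        ∃ Q : (W.baseChange (ringClassField K ι n)).toAffine.Point,
          ((p ^ s : ℕ) : ℤ) • Q = d.derivedPoint :=
  rowDivisibilityIrredAddv_of_prop37_2_of_poitouTate_of_Gross1991 h37 hPT hF1 W hcm K hK hD3 hD4 hH p hp2 hadd hj hirr hcp
    htam (fun h2 ↦ absurd h2 (not_isKolyvaginPrime_two_of_heegnerHypothesis_two h2K)) Dt β ι d₁ hy q hqN hq2 hqp

/-- **S2 on a row of crux 20165 with `p ≠ 3`** (the whole K8-t′ face `p ≥ 5`), from the three named facts ONLY — the row twin of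
k8t-c4 g12's `divisibilityIrredAddv_ne_three_of_prop47P2_…`. CONDITIONAL on the three facts; nothing asserted. [cite: GrossLMS1991, §3 (3.3), Prop. 3.7 (2)] -/
theorem rowDivisibilityIrredAddv_of_namedFacts_of_ne_three
    (h37 : GrossLMS1991.prop37_2_frobeniusCongruence)
    (hPT : ∀ (K : Type) [Field K] [NumberField K], poitouTate_selmerStructure_duality_conj K)
    (hF1 : Gross1991_heegnerPoint_sub_ratTorsion_mem_E0_imageFree)
    (W : WeierstrassCurve ℚ) [W.IsElliptic] [W.IsGloballyMinimal] [NeZero (W.conductorNorm ℤ)]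
    (hcm : ¬ W.HasCM) (K : Type) [Field K] [NumberField K] (hK : IsImaginaryQuadratic K)
    (hD3 : NumberField.discr K ≠ -3) (hD4 : NumberField.discr K ≠ -4)
    (hH : SatisfiesHeegnerHypothesis (W.conductorNorm ℤ) K)
    (p : ℕ) [Fact p.Prime] (hp2 : p ≠ 2) (hp3 : p ≠ 3) (hadd : Addv W p)
    (hj : 0 ≤ padicValRat p W.j) (hirr : W.HasIrreducibleModPGaloisRep p)
    (hcp : ¬ p ∣ (W.baseChange ℚ_[p]).localTamagawaNumber ℤ_[p])
    (htam : ∀ (q' : ℕ) [Fact q'.Prime], q' ∣ W.conductorNorm ℤ →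
      p ∣ (W.baseChange ℚ_[q']).localTamagawaNumber ℤ_[q'] → ¬ q' ^ 2 ∣ W.conductorNorm ℤ)
    (Dt : ModularParametrizationData W (W.conductorNorm ℤ)) (β : ℤ) (ι : K →+* ℂ)
    (d₁ : KolyvaginHeegnerData Dt β ι 1) (hy : ¬ IsOfFinAddOrder d₁.derivedPoint)
    (q : ℕ) [Fact q.Prime] (hqN : q ∣ W.conductorNorm ℤ) (hq2 : ¬ q ^ 2 ∣ W.conductorNorm ℤ) (hqp : q ≠ p) :
    ∀ (s : ℕ), s ≤ padicValNat p ((W.baseChange ℚ_[q]).localTamagawaNumber ℤ_[q]) →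
      ∀ (n : ℕ) (d : KolyvaginHeegnerData Dt β ι n), Squarefree n →
        (∀ ℓ ∈ n.primeFactors, Zhang2014.IsKolyvaginPrime (W.conductorNorm ℤ) W K p ℓ ∧
          s ≤ Zhang2014.kolyvaginIndex W p ℓ) →
        ∃ Q : (W.baseChange (ringClassField K ι n)).toAffine.Point,
          ((p ^ s : ℕ) : ℤ) • Q = d.derivedPoint :=
  rowDivisibilityIrredAddv_of_prop37_2_of_poitouTate_of_Gross1991 h37 hPT hF1 W hcm K hK hD3 hD4 hH p hp2 hadd hj hirr hcp
    htam (fun h2 ↦ absurd h2 fun h ↦ hp3 (eq_three_of_isKolyvaginPrime_two h)) Dt β ι d₁ hy q hqN hq2 hqp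

end Summit.BirchSwinnertonDyer.BirchSwinnertonDyer.Theorems.JetchevIrreducibleSwapAtP

end
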